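import Literature.AnabelianGeometry.EtaleTheta.Discharge.Sec2Prop214iiiMonoInduces
import Literature.AnabelianGeometry.EtaleTheta.Discharge.Sec2Prop214iiiTranslationsOfModel
import HarnessLib

/-!
# [EtTh] Prop 2.14 (iii), BI case: the automorphism over `conjX(x^a)`, `M ∣ a`, INDUCES conjugation by
# `x^a` on `Π^tp_Y` — in the currency `RigidData.Induces` of the typed statement `Prop214_iii_bi`

Mochizuki, *The Étale Theta Function …* [EtTh], Publ. RIMS 45 (2009), §2, Prop 2.14 (iii), PRIMS PDF
p.50 (bib key `MochizukiEtTh2009`): "the image of the resulting homomorphism … contains … `(N·l·ℤ) ⋊ {±1}`".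

PROOF-ONLY companion (no `def`; seat abc-iut-L2-t2) of `ThetaRigidity.lean` (`Prop214_iii_bi`) and
`Discharge/Sec2Prop214iiiTranslationsOfModel.lean` (`exists_biIso_conjX_zpow_of_model`): at abc-iut-L2-t8's
model tower, for a GEOMETRIC `x ∈ Π^tp_{X̲̲}` (`aug x = 1`), `M ∣ a` and any theta cocycle of level `M`,
there are an automorphism `α` of the model BI-theta environment and an induced `a' = conj(x^a)` on
`Π^tp_{Y̲̲}` with `Induces α a'` (`RigidData.exists_induces_of_right_eq`) — the existence half of the
`⊇ (N·l·ℤ)`-clause of `Prop214_iii_bi` WITHOUT the cusp-label bookkeeping `ActsOnCuspsBy`; conditional on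
Prop 1.5 (ii), (iii). HONEST FRAMING: [EtTh] is refereed; no side is taken on [IUTchIII] Cor 3.12; nothing
beyond the displayed statements is claimed.
-/

noncomputable section

namespace Literature.AnabelianGeometry.EtaleTheta

open Literature.AnabelianGeometry.SemiGraphs

namespace ThetaSetting.EtaleThetaData.DoubleUnderline

variable {p : ℕ} [Fact p.Prime] {D : ThetaSetting p} {E : D.EtaleThetaData} {l : ℕ}
  (C : E.DoubleUnderline l) {Es : Set ℕ+} (τ : D.CyclotomeTower l Es)

/-- **Prop 2.14 (iii), bi case, at the §1 MODEL tower, in the typed currency**: for a geometric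
`x ∈ Π^tp_{X̲̲}` (`aug x = 1`), `M ∣ a`, and any theta cocycle `η` of level `M` (each is the reduction of a
root cocycle), there are an automorphism `α` of the model bi-theta environment `B_M(η)` of
`R := C.rigidData (τ.mod M) hC hS h15 L` and a bi-continuous automorphism `a'` of `Π^tp_{Y̲̲}` with
`R.Induces α a'` and `a' = conj(x^a)` — conditional on Prop 1.5 (ii), (iii).
[cite: MochizukiEtTh2009, Prop 2.14(iii) p.50] -/
theorem exists_biIso_induces_of_model (hC : D.Compat) (hS : D.Sec2Hyps) (h15 : Prop15iii E hC)
    (h15ii : Prop15ii E.toKummerData hC) (L : C.CuspLabels) (M : Es)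
    {η : (C.rigidData (τ.mod M) hC hS h15 L).PiYdd → (C.rigidData (τ.mod M) hC hS h15 L).mu}
    (hη : η ∈ (C.rigidData (τ.mod M) hC hS h15 L).thetaCocycles)
    (x : C.Huu) (hx : D.aug.toMonoidHom (x : D.PiTemp) = 1) (a : ℤ) (ha : (((M : ℕ+) : ℕ) : ℤ) ∣ a) :
    ∃ (α : ((C.rigidData (τ.mod M) hC hS h15 L).modelBi hη).Iso
        ((C.rigidData (τ.mod M) hC hS h15 L).modelBi hη))
      (a' : (C.rigidData (τ.mod M) hC hS h15 L).PiY ≃ₜ* (C.rigidData (τ.mod M) hC hS h15 L).PiY),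
      (C.rigidData (τ.mod M) hC hS h15 L).Induces α.e.toMulEquiv a' ∧
      ∀ y, ((a' y : (C.rigidData (τ.mod M) hC hS h15 L).PiY) : (C.rigidData (τ.mod M) hC hS h15 L).PiX) =
        x ^ a * (y : (C.rigidData (τ.mod M) hC hS h15 L).PiX) * (x ^ a)⁻¹ := by
  obtain ⟨f, hf, rfl⟩ := hη
  obtain ⟨α, hα⟩ := C.exists_biIso_conjX_zpow_of_model τ hC hS h15 h15ii M hf x hx a ha
  obtain ⟨a', hind, ha'⟩ := (C.rigidData (τ.mod M) hC hS h15 L).exists_induces_of_right_eq (x ^ a)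
    α.e.toMulEquiv (fun z => by rw [show α.e.toMulEquiv z = α.e z from rfl, hα z]; rfl)
  exact ⟨α, a', hind, ha'⟩

end ThetaSetting.EtaleThetaData.DoubleUnderline

end Literature.AnabelianGeometry.EtaleTheta

end
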